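import Summits.QuantumFields.QCD.Theorems.EulerDescentHonestHeavyAnchorSplit
import Summits.QuantumFields.QCD.Theorems.EulerDescentHonestHeavyAnchorIntrinsicCornerAssembly
import Summits.QuantumFields.QCD.Theorems.EulerDescentHonestHeavyAnchorStubOffsetBoundedBelow

/-!
# `EulerDescent.HonestHeavyAnchor` (stmt-QuantumFields-16901) BY NAME from the RAY split of line `bounded_locator`
# (lead, cycle 1, rev 3): threshold anchor + branch transition + massive ray ABOVE + non-massive point BELOW

`honestHeavyAnchor_of_threshold_of_branchTransition_of_rays : S1 → T → U → R → HonestHeavyAnchor` where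

* `S1` = verbatim the statement of `HeavyThresholdYMBridge.ThresholdQCD` (stmt-QuantumFields-8794; the unpinned heavy anchor);
* `T` (BRANCH TRANSITION, fixed coupling) = for `N_f ∈ {2,3}` there is `β₀` such that at every `β ≥ β₀` some degenerate bare
  Wilson mass `μ > −1/2` is NON-massive (a transition of the Wilson axis on the physical branch at fixed weak coupling — the
  non-empty half of the corner law in its weakest useful form: no "closing", no rate);
* `U` (MASSIVE RAY ABOVE, = registered stub `stub_uniformlyMassiveAboveOfBody`) = every mass-scaling, asymptotically scaling
  regularisation carrying the heavy body above `M` is, for some `M'`, eventually uniformly massive on the ray of degenerate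
  bare masses `≥ m_crit(k) + a_k M'/Z_m(k)`;
* `R` (NON-MASSIVE POINT BELOW, "relative transition") = every such regularisation admits `C` such that eventually SOME
  degenerate bare mass `≥ m_crit(k) − a_k C/Z_m(k)` is non-massive at `β_k` — the construction's critical mass sits within
  bounded RGI depth ABOVE a transition of its own lattice theories (the content of the upper locator S4', corner-free).

WHY THIS SPLIT (against rev 2 = S1, B, N, U, S4'): the intrinsic corner `mc k := sup NonMassive(β_k)` and both locator
bounds are ASSEMBLED here by order bookkeeping — non-empty by `R` (or `T`), bounded above by `U`
(`HonestHeavyAnchorIntrinsicCorner.isLUB_sSup_of_mem_of_barrier`), `−M' ≤ offset ≤ C` from `U`/`R`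
(`HonestHeavyAnchorLowerLocator.corner_le_ray_iff`), and the physical branch after re-pinning from `mc k > −1/2` (`T` along
`β_k → +∞`) instead of `mc k → 0`.  So the weak-coupling massive barrier `B` of rev 2 (lattice Yang–Mills clustering at EVERY
large `β`, uniformly — a hypothesis the crux does NOT imply) is no longer needed, and neither is `mc → 0`: the line's
hypothesis set shrinks to statements each of which is implied by the crux at its own witness (`S1`:
`HonestHeavyAnchorSplit.thresholdQCD_of_honestHeavyAnchor`; `U`: `HonestHeavyAnchorLowerLocator.massive_rays_of_honestHeavyAnchor`;
`R`: `nonMassive_below_of_honestHeavyAnchor` here) except the fixed-coupling packaging of `T`.  The rest is rev 1's glue: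
Bolzano–Weierstrass on the offset, `QCDRegularisation.restrict`, re-pin by the subsequential limit
(`HonestHeavyAnchorSplit.scheme_repin` & co.).  Nothing here proves physics; standard axioms; no `def`.
-/

namespace Summit.QuantumFields.QCD.Theorems.HonestHeavyAnchorRaySplit

open Filter Topology
open Literature.MathematicalPhysics.QuantumFieldTheory
open Summit.QuantumFields.QCD.Theses
open Summit.QuantumFields.QCD.Theorems.HonestHeavyAnchorSplit
open Summit.QuantumFields.QCD.Theorems.HonestHeavyAnchorIntrinsicCorner (isLUB_sSup_of_mem_of_barrier)
open Summit.QuantumFields.QCD.Theorems.HonestHeavyAnchorLowerLocator (corner_le_ray_iff)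

variable {Nf : ℕ}

/-- `m_crit(k) − a_k C/Z_m(k) ≤ c` iff `(m_crit(k) − c)·Z_m(k)/a_k ≤ C` (`a_k, Z_m(k) > 0`). [folklore] -/
theorem ray_below_le_corner_iff (reg : QCDRegularisation Nf) (c C : ℝ) (k : ℕ) :
    reg.mcrit k - reg.a k * C / reg.Zm k ≤ c ↔ (reg.mcrit k - c) * reg.Zm k / reg.a k ≤ C := by
  have ha := reg.a_pos k
  have hZ := reg.Zm_pos k
  rw [div_le_iff₀ ha, sub_le_comm, le_div_iff₀ hZ]
  constructor <;> intro h <;> nlinarith [h]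

/-- **The RAY split glue**: `HonestHeavyAnchor` from the threshold anchor `S1`, the branch transition `T`, the massive ray
above `U` and the non-massive point below `R` (registered sub-goal of the crux item; see the module docstring for the four
statements).  Proof: for the threshold regularisation `reg` the non-massive set at `β_k` is eventually non-empty (`R`) and
bounded above by the massive ray (`U`), so `mc k := sSup` is its least upper bound with
`m_crit(k) − a_k C/Z_m(k) ≤ mc k ≤ m_crit(k) + a_k M'/Z_m(k)` (offset in `[−M', C]`) and `mc k > −1/2` (`T` along `β_k → ∞`);
Bolzano–Weierstrass extracts `φ` with `offset ∘ φ → c`; the witness is `reg` restricted to `φ` and re-pinned by `c`, with corner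
`mc ∘ φ` and threshold `M + |c| + 1`; its critical mass is `mc ∘ φ + (a/Z_m)∘φ · (offset ∘ φ − c) > −1` eventually. [folklore] -/
theorem honestHeavyAnchor_of_threshold_of_branchTransition_of_rays :
    (∀ Nf : ℕ, Nf = 2 ∨ Nf = 3 → ∃ M₀ : ℝ, 0 ≤ M₀ ∧ ∃ reg : QCDRegularisation Nf, reg.HasMassScaling ∧
      ∀ m : Fin Nf → ℝ, (∀ f, M₀ < m f) → ∃ (z shift : QCDField Nf → ℕ → ℝ) (T : OSData (QCDField Nf) 4),
        IsQCDAlong (reg.scheme m z shift) T ∧ T.IsNontrivial QCDField.glue ∧ T.IsNonGaussian QCDField.glue ∧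
          (∀ f g : Fin Nf, f ≠ g → T.IsNontrivial (QCDField.pseudoRe f g)) ∧
            ∃ Δ > 0, T.HasMassGap Δ ∧ (reg.scheme m z shift).HasLatticeMassGap Δ) →
    (∀ Nf : ℕ, Nf = 2 ∨ Nf = 3 → ∃ β₀ : ℝ, ∀ β : ℝ, β₀ ≤ β → ∃ μ : ℝ, -(1 / 2 : ℝ) < μ ∧
      ¬ (∀ (R R' : ℕ) (A : QCDLatticeObservable Nf R) (B : QCDLatticeObservable Nf R'),
        ∃ (C δ : ℝ) (S₀ : ℕ), 0 < δ ∧ ∀ S : ℕ, S₀ ≤ S → ∀ n : ℕ, n ≤ S →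
          ‖qcdLatticeConnectedCorr β (2 * S + 1) (fun _ : Fin Nf => μ) A B n‖ ≤ C * Real.exp (-(δ * n)))) →
    (∀ Nf : ℕ, Nf = 2 ∨ Nf = 3 → ∀ (reg : QCDRegularisation Nf) (M : ℝ), reg.HasMassScaling →
      (reg.scheme 0 0 0).HasAsymptoticScaling →
      (∀ m : Fin Nf → ℝ, (∀ f, M < m f) → ∃ (z shift : QCDField Nf → ℕ → ℝ) (T : OSData (QCDField Nf) 4),
        IsQCDAlong (reg.scheme m z shift) T ∧ T.IsNontrivial QCDField.glue ∧ T.IsNonGaussian QCDField.glue ∧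
          (∀ f g : Fin Nf, f ≠ g → T.IsNontrivial (QCDField.pseudoRe f g)) ∧
            ∃ Δ > 0, T.HasMassGap Δ ∧ (reg.scheme m z shift).HasLatticeMassGap Δ) →
      ∃ M' : ℝ, ∀ᶠ k in atTop, ∀ μ : ℝ, reg.mcrit k + reg.a k * M' / reg.Zm k ≤ μ →
        ∀ (R R' : ℕ) (A : QCDLatticeObservable Nf R) (B : QCDLatticeObservable Nf R'), ∃ (C δ : ℝ) (S₀ : ℕ),
          0 < δ ∧ ∀ S : ℕ, S₀ ≤ S → ∀ n : ℕ, n ≤ S →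
            ‖qcdLatticeConnectedCorr (reg.β k) (2 * S + 1) (fun _ : Fin Nf => μ) A B n‖ ≤ C * Real.exp (-(δ * n))) →
    (∀ Nf : ℕ, Nf = 2 ∨ Nf = 3 → ∀ (reg : QCDRegularisation Nf) (M : ℝ), reg.HasMassScaling →
      (reg.scheme 0 0 0).HasAsymptoticScaling →
      (∀ m : Fin Nf → ℝ, (∀ f, M < m f) → ∃ (z shift : QCDField Nf → ℕ → ℝ) (T : OSData (QCDField Nf) 4),
        IsQCDAlong (reg.scheme m z shift) T ∧ T.IsNontrivial QCDField.glue ∧ T.IsNonGaussian QCDField.glue ∧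
          (∀ f g : Fin Nf, f ≠ g → T.IsNontrivial (QCDField.pseudoRe f g)) ∧
            ∃ Δ > 0, T.HasMassGap Δ ∧ (reg.scheme m z shift).HasLatticeMassGap Δ) →
      ∃ C : ℝ, ∀ᶠ k in atTop, ∃ μ : ℝ, reg.mcrit k - reg.a k * C / reg.Zm k ≤ μ ∧
        ¬ (∀ (R R' : ℕ) (A : QCDLatticeObservable Nf R) (B : QCDLatticeObservable Nf R'), ∃ (C δ : ℝ) (S₀ : ℕ),
          0 < δ ∧ ∀ S : ℕ, S₀ ≤ S → ∀ n : ℕ, n ≤ S →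
            ‖qcdLatticeConnectedCorr (reg.β k) (2 * S + 1) (fun _ : Fin Nf => μ) A B n‖ ≤ C * Real.exp (-(δ * n)))) →
    Summit.QuantumFields.QCD.Theses.EulerDescent.HonestHeavyAnchor := by
  intro hA hT hU hR Nf hNf
  have hNf16 : Nf ≤ 16 := by rcases hNf with rfl | rfl <;> norm_num
  -- (S1) the unpinned heavy-threshold anchor; asymptotic scaling read off the body at the tuple `M + 1`
  obtain ⟨M, hM, reg, hms, hbody⟩ := hA Nf hNf
  have haf : (reg.scheme 0 0 0).HasAsymptoticScaling := by
    obtain ⟨z, shift, T, hqcd, -⟩ := hbody (fun _ => M + 1) (fun _ => lt_add_one M)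
    exact hqcd.1
  have hβ : Tendsto reg.β atTop atTop :=
    QCDRegularisation.tendsto_beta_atTop_of_hasAsymptoticScaling hNf16 reg 0 0 0 haf
  -- the non-massive sets of `reg`'s own lattice theories
  set N : ℕ → Set ℝ := fun k => {μ : ℝ | ¬ (∀ (R R' : ℕ) (A : QCDLatticeObservable Nf R)
      (B : QCDLatticeObservable Nf R'), ∃ (C δ : ℝ) (S₀ : ℕ), 0 < δ ∧ ∀ S : ℕ, S₀ ≤ S → ∀ n : ℕ, n ≤ S →
        ‖qcdLatticeConnectedCorr (reg.β k) (2 * S + 1) (fun _ : Fin Nf => μ) A B n‖ ≤ C * Real.exp (-(δ * n)))}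
    with hN
  -- (U) massive ray above, (R) non-massive point below, (T) a non-massive point above `−1/2` along `β_k → ∞`
  obtain ⟨M', hray⟩ := hU Nf hNf reg M hms haf hbody
  obtain ⟨C, hbelow⟩ := hR Nf hNf reg M hms haf hbody
  obtain ⟨β₀, hβ₀⟩ := hT Nf hNf
  -- the corner `mc k := sSup (N k)` and its sandwich
  set mc : ℕ → ℝ := fun k => sSup (N k) with hmc
  have hsand : ∀ᶠ k in atTop, IsLUB (N k) (mc k) ∧ reg.mcrit k - reg.a k * C / reg.Zm k ≤ mc k ∧
      mc k ≤ reg.mcrit k + reg.a k * M' / reg.Zm k ∧ -(1 / 2 : ℝ) < mc k := by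
    filter_upwards [hray, hbelow, hβ.eventually_ge_atTop β₀] with k hk₁ hk₂ hk₃
    obtain ⟨μ, hμge, hμN⟩ := hk₂
    have hμN' : μ ∈ N k := hμN
    have hbar : ∀ ν : ℝ, reg.mcrit k + reg.a k * M' / reg.Zm k ≤ ν → ν ∉ N k := fun ν hν hνN => hνN (hk₁ ν hν)
    obtain ⟨hlub, hμle, hle⟩ := isLUB_sSup_of_mem_of_barrier (N k) μ _ hμN' hbar
    obtain ⟨ν, hνgt, hνN⟩ := hβ₀ (reg.β k) hk₃
    have hνN' : ν ∈ N k := hνN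
    exact ⟨hlub, hμge.trans hμle, hle, hνgt.trans_le (hlub.1 hνN')⟩
  have hcorner : ∀ᶠ k in atTop, IsLUB (N k) (mc k) := hsand.mono fun k hk => hk.1
  have hlo : ∀ᶠ k in atTop, -M' ≤ (reg.mcrit k - mc k) * reg.Zm k / reg.a k :=
    hsand.mono fun k hk => (corner_le_ray_iff reg (mc k) M' k).1 hk.2.2.1
  have hhi : ∀ᶠ k in atTop, (reg.mcrit k - mc k) * reg.Zm k / reg.a k ≤ C :=
    hsand.mono fun k hk => (ray_below_le_corner_iff reg (mc k) C k).1 hk.2.1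
  have hbr : ∀ᶠ k in atTop, -(1 / 2 : ℝ) < mc k := hsand.mono fun k hk => hk.2.2.2
  -- Bolzano–Weierstrass on the offset; restrict to `φ`; re-pin by the subsequential limit `c`
  obtain ⟨c, φ, hφ, hlim⟩ :=
    exists_subseq_tendsto_of_eventually_bounded (fun k => (reg.mcrit k - mc k) * reg.Zm k / reg.a k) hlo hhi
  have hφt : Tendsto φ atTop atTop := hφ.tendsto_atTop
  set reg₁ : QCDRegularisation Nf := reg.restrict φ hφt with hreg₁
  let reg₂ : QCDRegularisation Nf := { reg₁ with mcrit := fun k => reg₁.mcrit k - reg₁.a k * c / reg₁.Zm k }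
  have hms₁ : reg₁.HasMassScaling := by
    obtain ⟨c', hc', ht⟩ := hms
    exact ⟨c', hc', ht.comp hφt⟩
  have hoff₁ : Tendsto (fun k => (reg₁.mcrit k - mc (φ k)) * reg₁.Zm k / reg₁.a k) atTop (𝓝 c) := hlim
  have haZ₁ : Tendsto (fun k => reg₁.a k / reg₁.Zm k) atTop (𝓝 0) :=
    tendsto_a_div_Zm reg₁ hms₁ (massExponent_nonneg hNf)
  refine ⟨reg₂, mc ∘ φ, M + |c| + 1, ?_, ?_, hms₁, ?_, ?_, ?_, ?_⟩
  · -- corner along `φ` (reads only `β`)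
    exact hφt.eventually hcorner
  · -- pin: `offset ∘ φ − c → 0`
    have h : Tendsto (fun k => (reg₁.mcrit k - mc (φ k)) * reg₁.Zm k / reg₁.a k - c) atTop (𝓝 (c - c)) :=
      hoff₁.sub_const c
    rw [sub_self] at h
    refine h.congr' (Eventually.of_forall fun k => ?_)
    exact (cornerOffset_repin reg₁ c (mc ∘ φ) k).symm
  · -- asymptotic scaling (reads only `β, a`)
    obtain ⟨Λ, hΛ, ht⟩ := haf
    exact ⟨Λ, hΛ, ht.comp hφt⟩
  · -- physical branch: `m_crit₂ = mc ∘ φ + (a/Z_m)·(offset − c)`, the product term is eventually `> −1/2`, `mc ∘ φ > −1/2`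
    have hD : Tendsto (fun k => (reg₁.mcrit k - mc (φ k)) * reg₁.Zm k / reg₁.a k - c) atTop (𝓝 0) := by
      simpa using hoff₁.sub_const c
    have hprod : Tendsto (fun k => reg₁.a k / reg₁.Zm k * ((reg₁.mcrit k - mc (φ k)) * reg₁.Zm k / reg₁.a k - c))
        atTop (𝓝 0) := by
      simpa using haZ₁.mul hD
    filter_upwards [hφt.eventually hbr, hprod.eventually_const_lt (by norm_num : (-(1 / 2) : ℝ) < 0)] with k hk₁ hk₂
    have heq := repin_mcrit_eq reg₁ c (mc ∘ φ) k
    change (-1 : ℝ) < reg₁.mcrit k - reg₁.a k * c / reg₁.Zm k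
    rw [heq]
    change -(1 / 2 : ℝ) < mc (φ k) at hk₁
    change -(1 / 2 : ℝ) < reg₁.a k / reg₁.Zm k * ((reg₁.mcrit k - (mc ∘ φ) k) * reg₁.Zm k / reg₁.a k - c) at hk₂
    have : (mc ∘ φ) k = mc (φ k) := rfl
    linarith
  · -- threshold positive
    have h := abs_nonneg c
    linarith [hM]
  · -- heavy body above `M + |c| + 1`: run `reg` along `φ` at `m − c > M`
    intro m hm
    have hm' : ∀ f, M < m f - c := fun f => by
      have h1 := hm f
      have h2 := le_abs_self c
      linarith
    obtain ⟨z, shift, T, ⟨hAS, hbrq, hconv⟩, hNt, hG, hP, Δ, hΔ, hTg, hL⟩ := hbody (fun f => m f - c) hm'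
    refine ⟨fun s => z s ∘ φ, fun s => shift s ∘ φ, T, ?_, hNt, hG, hP, Δ, hΔ, hTg, ?_⟩
    · rw [scheme_repin]
      refine ⟨?_, fun fl => hφt.eventually (hbrq fl), fun n hn σ f F hF hoffd => ?_⟩
      · obtain ⟨Λ, hΛ, ht⟩ := hAS
        exact ⟨Λ, hΛ, ht.comp hφt⟩
      · exact (hconv n hn σ f F hF hoffd).comp hφt
    · rw [scheme_repin]
      intro R R' A B
      obtain ⟨C', hCb⟩ := hL R R' A B
      exact ⟨C', hφt.eventually hCb⟩

/-- **`R` is necessary at the witness**: the crux's own regularisation has, for every `C > 0`, eventually a NON-massive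
degenerate bare mass `≥ m_crit(k) − a_k C/Z_m(k)` (corner = least upper bound of the non-massive set, and the pin puts
`m_crit(k) − a_k C/Z_m(k)` strictly below the corner eventually). [folklore] -/
theorem nonMassive_below_of_honestHeavyAnchor (h : Summit.QuantumFields.QCD.Theses.EulerDescent.HonestHeavyAnchor)
    (hNf : Nf = 2 ∨ Nf = 3) :
    ∃ reg : QCDRegularisation Nf, reg.HasMassScaling ∧ (reg.scheme 0 0 0).HasAsymptoticScaling ∧
      ∀ C : ℝ, 0 < C → ∀ᶠ k in atTop, ∃ μ : ℝ, reg.mcrit k - reg.a k * C / reg.Zm k ≤ μ ∧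
        ¬ (∀ (R R' : ℕ) (A : QCDLatticeObservable Nf R) (B : QCDLatticeObservable Nf R'), ∃ (C δ : ℝ) (S₀ : ℕ),
          0 < δ ∧ ∀ S : ℕ, S₀ ≤ S → ∀ n : ℕ, n ≤ S →
            ‖qcdLatticeConnectedCorr (reg.β k) (2 * S + 1) (fun _ : Fin Nf => μ) A B n‖ ≤ C * Real.exp (-(δ * n))) := by
  obtain ⟨reg, mc, Mh, hcorner, hpin, hms, haf, -⟩ := h Nf hNf
  refine ⟨reg, hms, haf, fun C hC => ?_⟩
  filter_upwards [hcorner, hpin.eventually_lt_const hC] with k hk hlt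
  -- `m_crit(k) − a_k C/Z_m(k) < mc k`, so some member of the set lies above it
  have hlt' : reg.mcrit k - reg.a k * C / reg.Zm k < mc k := by
    have ha := reg.a_pos k
    have hZ := reg.Zm_pos k
    rw [div_lt_iff₀ ha] at hlt
    rw [sub_lt_comm, lt_div_iff₀ hZ]
    nlinarith [hlt]
  obtain ⟨μ, hμN, hμgt, -⟩ := hk.exists_between hlt'
  exact ⟨μ, hμgt.le, hμN⟩

end Summit.QuantumFields.QCD.Theorems.HonestHeavyAnchorRaySplit
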